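import Literature.MathematicalPhysics.QuantumLattice.MatrixProductStatesProofs
import Literature.Probability.LatticeModels.LatticeGraph
import Mathlib.LinearAlgebra.UnitaryGroup
import HarnessLib

/-!
# Projected entangled pair states on the square torus and their parent Hamiltonians

Two-dimensional companion of `Literature/MathematicalPhysics/QuantumLattice/MatrixProductStates.lean`
(spin systems, `TensorIndex Λ q = Λ → Fin q`, `Op Λ q`, `localOp`). A *PEPS tensor* with physical
dimension `q` and bond dimension `D` is a five-index tensor `A^s_{l u r d}` (physical index `s`,
virtual legs left, up, right, down; Schuch–Cirac–Pérez-García 2010, Def. 2.2). We define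

* `pepsRect n m A X` — the state of an `n × m` block (`n` columns, `m` rows) of copies of `A`,
  internal bonds contracted, the `2m + 2n` open boundary legs closed with a boundary tensor `X`
  (the map `Γ_R : X ↦ Σ 𝒞[A_R X]` of Pérez-García–Verstraete–Wolf–Cirac 2008, §4; the sets
  `𝒮 = {ζ(X) | X}` of SCP2010 §5.2);
* `IsInjectivePEPS n m A` — injectivity of that block map (PVWC2008 §4 "the region is
  injective"; SCP2010 Def. 3.1, `𝒫(A)` has a left inverse; single site: `n = m = 1`);
* `pepsTorus L A` — the translation-invariant PEPS on the discrete torus `TorusSite 2 L =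
  (ℤ/L)²` (SCP2010 Def. 2.2, eq. (2)); `pepsTorusTwisted L A P Q` — the same contraction with
  matrices `P`, `Q` inserted on the bonds crossing the vertical, resp. horizontal, seam
  (SCP2010 Def. 5.6, the `(g,h)`-closed PEPS when `P = U_g`, `Q = U_h`);
* `pepsRange n m A` (`𝒮_{n×m}`), the local term `pepsLocalTerm n m A = 1 - Π_{𝒮_{n×m}}`
  (`projMatrix` of the orthogonal complement), its placement on the block of the torus anchored at
  `x` (`torusBlock`, `onTorusBlock`), and the **parent Hamiltonian**
  `pepsParentHamiltonian L n m A = Σ_{x ∈ (ℤ/L)²} h_x` (SCP2010 Thm. 5.7, eq. (31)–(32) with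
  `n = m = 2`; PVWC2008 §3 eq. (4));
* the NAMED FACT `pepsParent_groundSpace_of_injective`: for an injective tensor the `2 × 2`
  parent Hamiltonian on the `L × L` torus, `L ≥ 2`, has zero-energy space `ℂ · pepsTorus L A`
  (SCP2010 Thm. 5.7 with Thm. 5.9 for the trivial group; PVWC2008 §5 Thm. 3);
* `legAct`, `boundaryAct`, `IsSemiregularRep`, `IsGInjectivePEPS` and the NAMED FACT
  `pepsParent_groundSpace_of_GInjective` (SCP2010 Def. 4.5, Def. 5.1, Thm. 5.7: for a
  `G`-injective tensor w.r.t. a semi-regular unitary representation the zero-energy space is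
  spanned by the `(g,h)`-closed PEPS with `gh = hg`);
* proved: `pepsParentHamiltonian_posSemidef`, `pepsParentHamiltonian_isHermitian`,
  `pepsTorusTwisted_one_one` (trivial closures), `legAct_one`, `boundaryAct_one`,
  `isGInjectivePEPS_one_iff` (trivial group: `G`-injective = injective), the degenerate case
  `D = 0` (`pepsParentHamiltonian_eq_of_D_eq_zero`: `H = L² · 1`), and the bridge
  `pepsParent_groundSpace_of_injective_of_GInjective` : the `G`-injective fact specialised to the
  trivial group IS the injective fact (a type-level consistency check of the two statements).

## Conventions

Sites `x : TorusSite 2 L = Fin 2 → ZMod L`; coordinate `0` is horizontal (columns, increasing to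
the right), coordinate `1` vertical (rows, increasing DOWNWARDS), `e i = Pi.single i 1`. The
horizontal bond variable `η x` sits on the bond `x — x + e 0` (it is the right leg of `x` and the
left leg of `x + e 0`); the vertical bond variable `ν x` sits on `x — x + e 1` (down leg of `x`,
up leg of `x + e 1`). Leg order of a tensor is `A s l u r d`. In a block, sites are
`p = (a, b) : Fin n × Fin m` (`a` = column offset, `b` = row offset), horizontal bond variables are
indexed by `Fin (n+1) × Fin m` (index `a.castSucc` = left leg of column `a`, `a.succ` = its right
leg, so `0` and `Fin.last n` are the open left/right boundary legs) and vertical ones by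
`Fin n × Fin (m+1)`. Boundary tensors `X : PEPSBoundary D n m` take (left legs, up legs, right
legs, down legs). All pairings are BILINEAR (network contraction, no complex conjugation), as in
`mpsWithBoundary`. Twists: `P a b` weights (right leg `a` of the site in column `-1`) against
(left leg `b` of the site in column `0`), i.e. `⟨r| P |l⟩` in the ket/bra convention
`A = Σ A^s_{lurd} |s⟩|l,u⟩⟨r,d|` of SCP2010 eq. (3); likewise `Q` on the down/up legs across the
row seam `-1 | 0`.

## Degenerate values (documented junk)

`L = 1`: the `2 × 2` block placed on the one-site torus is not an honest relabelling (the anchor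
map `p ↦ x + p` is not injective); statements assume `2 ≤ L`. `D = 0`: every block map is
injective (its domain is `0`), `pepsTorus L A = 0`, `𝒮 = ⊥`, the local term is `1` and the fact
below holds trivially (`ker = ⊥ = ℂ · 0`). `q = 0`: the Hilbert space is `0`.

## What is NOT here (and why)

* No fermionic PEPS. Kraus–Schuch–Verstraete–Cirac, PRA 81 (2010) 052338 define fPEPS (§3) and
  prove a parent-Hamiltonian statement ONLY for Gaussian fPEPS (§5: quadratic Hamiltonians,
  unique ground state unless gapless); an injective-fPEPS analogue of the theorem below is not
  printed there, nor in Bultinck–Williamson–Haegeman–Verstraete, J. Phys. A 51 (2018) 025202 or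
  Wille–Buerschaper–Eisert, PRB 95 (2017) 245127 (ground spaces by closure counting). It is the
  `ℤ₂`-graded rerun of SCP2010 §5 and would have to be PROVED, not cited.
* No blocking isomorphism `(k × k block of A) ↦ PEPS tensor with q' = q^{k²}, D' = D^k`
  (SCP2010 Lemma 5.2); `pepsRect`/`IsInjectivePEPS` are stated for arbitrary blocks so that it
  can be added as a theorem.
* No proof of the fact (intersection property SCP2010 Thm. 5.4, closure Thm. 5.5): sizeable
  finite-dimensional linear algebra, cf. the 1D analogue `MatrixProductStatesIntersectionProofs`.

## Mathlib / tree search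

Mathlib has no tensor networks (`lean search 'PEPS|peps|tensorNetwork|parentHamiltonian'`: only the
tree's 1D `MatrixProductStates*`). Reused from the tree: `TensorIndex`, `SpinSpace`, `Op`,
`localOp` (`SpinSystem`), `projMatrix` (`FinDimSpectrum`), `posSemidef_localOp`,
`isHermitian_localOp`, `projMatrix_posSemidef` (`MatrixProductStatesProofs`), `TorusSite`
(`Probability.LatticeModels.LatticeGraph`).

## References

* D. Pérez-García, F. Verstraete, M. M. Wolf, J. I. Cirac, *PEPS as unique ground states of local
  Hamiltonians*, Quantum Inf. Comput. **8** (2008) 650–663, arXiv:0707.2260: §2 (PEPS, eq. (2)),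
  §3 (parent Hamiltonians, eq. (4)), §4 (injectivity, `Γ_R`, Lemmas 1–2), §5 Thm. 3 (uniqueness).
  [PerezGarciaVerstraeteWolfCirac2008PEPS]
* N. Schuch, I. Cirac, D. Pérez-García, *PEPS as ground states: degeneracy and topology*,
  Ann. Phys. **325** (2010) 2153–2192, arXiv:1001.3807: Def. 2.2–2.3, Def. 3.1, §5.2 Thm. 5.4
  (intersection), Thm. 5.5 (closure), Def. 5.6, Thm. 5.7 (parent Hamiltonian), Thm. 5.9
  (structure of the ground space). [SchuchCiracPerezGarcia2010]
-/

noncomputable section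

open Matrix Complex Finset
open scoped ComplexOrder

namespace Literature.MathematicalPhysics.QuantumLattice

open Literature.Probability.LatticeModels

section QLattice

/-! ### Tensors and block contractions -/

/-- The virtual (four-leg) tensors `X_{l u r d}`, `l u r d : Fin D` (left, up, right, down legs),
i.e. `(ℂ^D)^{⊗4}` in coordinates. Schuch–Cirac–Pérez-García (2010) Def. 2.2.
[cite: SchuchCiracPerezGarcia2010, Def. 2.2] -/
abbrev PEPSVirtual (D : ℕ) : Type := Fin D → Fin D → Fin D → Fin D → ℂ

/-- A **PEPS tensor** with physical dimension `q` and bond dimension `D`: a five-index tensor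
`A^s_{l u r d}`, physical index `s : Fin q`, virtual legs left, up, right, down in `Fin D`.
Pérez-García–Verstraete–Wolf–Cirac (2008) §2; Schuch–Cirac–Pérez-García (2010) Def. 2.2, eq. (3).
[cite: SchuchCiracPerezGarcia2010, Def. 2.2] -/
abbrev PEPSTensor (q D : ℕ) : Type := Fin q → PEPSVirtual D

/-- Boundary tensors of an `n × m` block (`n` columns, `m` rows): functions of the open legs
(left legs of the `m` rows, up legs of the `n` columns, right legs, down legs), i.e.
`(ℂ^D)^{⊗(2m+2n)}` in coordinates — the domain of `Γ_R`. Pérez-García–Verstraete–Wolf–Cirac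
(2008) §4. [cite: PerezGarciaVerstraeteWolfCirac2008PEPS, §4] -/
abbrev PEPSBoundary (D n m : ℕ) : Type :=
  (Fin m → Fin D) → (Fin n → Fin D) → (Fin m → Fin D) → (Fin n → Fin D) → ℂ

variable {q D : ℕ}

/-- The weight of one assignment of all bond variables of an `n × m` block: the product over the
sites `p = (a, b)` of `A^{σ p}_{l u r d}` with `l = η (a, b)` read at `a.castSucc`, `r` at `a.succ`,
`u = ν (a, b)` read at `b.castSucc`, `d` at `b.succ` (see the module docstring for conventions).
[cite: PerezGarciaVerstraeteWolfCirac2008PEPS, §4] -/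
def pepsRectWeight (n m : ℕ) (A : PEPSTensor q D) (σ : TensorIndex (Fin n × Fin m) q)
    (η : Fin (n + 1) × Fin m → Fin D) (ν : Fin n × Fin (m + 1) → Fin D) : ℂ :=
  ∏ p : Fin n × Fin m,
    A (σ p) (η (p.1.castSucc, p.2)) (ν (p.1, p.2.castSucc)) (η (p.1.succ, p.2)) (ν (p.1, p.2.succ))

/-- **The block map `Γ_R`** of an `n × m` block `R`: the physical state obtained by contracting
the copies of `A` inside the block and closing the open boundary legs with the boundary tensor
`X`, `ψ_X(σ) = Σ_{η, ν} (Π_p A^{σ p}_{…}) · X(left legs, up legs, right legs, down legs)`. It is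
linear in `X`. Pérez-García–Verstraete–Wolf–Cirac (2008) §4 (`Γ_R(C) = Σ 𝒞[A_{i_R} C] |i_R⟩`);
Schuch–Cirac–Pérez-García (2010) §5.2 (the sets `{ζ(X) | X}`).
[cite: PerezGarciaVerstraeteWolfCirac2008PEPS, §4] -/
def pepsRect (n m : ℕ) (A : PEPSTensor q D) (X : PEPSBoundary D n m) :
    TensorIndex (Fin n × Fin m) q → ℂ :=
  fun σ => ∑ η : Fin (n + 1) × Fin m → Fin D, ∑ ν : Fin n × Fin (m + 1) → Fin D,
    pepsRectWeight n m A σ η ν *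
      X (fun b => η (0, b)) (fun a => ν (a, 0)) (fun b => η (Fin.last n, b))
        (fun a => ν (a, Fin.last m))

/-- **Injectivity** of the `n × m` block: the block map `X ↦ ψ_X` is injective (equivalently, being
linear, has a left inverse). Single-site injectivity is `n = m = 1`. Degenerate value: for `D = 0`
the domain is `0` and every block is injective. Pérez-García–Verstraete–Wolf–Cirac (2008) §4
("if `Γ_R` is an injective map, we will simply say that the region `R` is injective");
Schuch–Cirac–Pérez-García (2010) Def. 3.1. [cite: SchuchCiracPerezGarcia2010, Def. 3.1] -/
def IsInjectivePEPS (n m : ℕ) (A : PEPSTensor q D) : Prop :=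
  Function.Injective (pepsRect n m A)

/-! ### The PEPS on the torus, closures -/

/-- The unit vector `e i` of the discrete torus `(ℤ/L)²`. [folklore] -/
def torusUnit (L : ℕ) (i : Fin 2) : TorusSite 2 L := Pi.single i 1

/-- **The PEPS on the `L × L` torus** built from one tensor `A`:
`ψ(σ) = Σ_{η ν} Π_x A^{σ x}_{η(x - e 0), ν(x - e 1), η x, ν x}`, the sum running over all
assignments of the horizontal (`η`) and vertical (`ν`) bond variables (module docstring for the
conventions). Pérez-García–Verstraete–Wolf–Cirac (2008) §2, eq. (2); Schuch–Cirac–Pérez-García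
(2010) Def. 2.2, eq. (2). [cite: SchuchCiracPerezGarcia2010, Def. 2.2] -/
def pepsTorus (L : ℕ) [NeZero L] (A : PEPSTensor q D) : TensorIndex (TorusSite 2 L) q → ℂ :=
  fun σ => ∑ η : TorusSite 2 L → Fin D, ∑ ν : TorusSite 2 L → Fin D,
    ∏ x, A (σ x) (η (x - torusUnit L 0)) (ν (x - torusUnit L 1)) (η x) (ν x)

/-- The weight of a bond carrying the matrix `P` when it crosses the seam (`cross = true`) and the
identity otherwise: `P a b`, resp. `δ_{a b}`. [folklore] -/
def seamWeight (P : Matrix (Fin D) (Fin D) ℂ) (cross : Prop) [Decidable cross] (a b : Fin D) : ℂ :=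
  if cross then P a b else if a = b then 1 else 0

/-- **The PEPS on the torus with closures** `P` (on the horizontal bonds crossing the vertical seam
between column `-1` and column `0`) and `Q` (on the vertical bonds crossing the horizontal seam
between row `-1` and row `0`): every bond carries two variables, the right/down leg `η x`, `ν x`
of `x` and the left/up leg `η' x`, `ν' x` of the neighbour, paired with `P (η x) (η' x)` on seam
bonds and `δ` elsewhere. For a unitary representation `U` this is the `(g,h)`-closed PEPS
`|Ψ(A | (g,h))⟩` with `P = U_g`, `Q = U_h`; `P = Q = 1` gives back `pepsTorus`
(`pepsTorusTwisted_one_one`). Schuch–Cirac–Pérez-García (2010) Def. 5.6, eq. (30).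
[cite: SchuchCiracPerezGarcia2010, Def. 5.6] -/
def pepsTorusTwisted (L : ℕ) [NeZero L] (A : PEPSTensor q D) (P Q : Matrix (Fin D) (Fin D) ℂ) :
    TensorIndex (TorusSite 2 L) q → ℂ :=
  fun σ => ∑ η : TorusSite 2 L → Fin D, ∑ η' : TorusSite 2 L → Fin D,
    ∑ ν : TorusSite 2 L → Fin D, ∑ ν' : TorusSite 2 L → Fin D,
      (∏ x, A (σ x) (η' (x - torusUnit L 0)) (ν' (x - torusUnit L 1)) (η x) (ν x)) *
        ((∏ x, seamWeight P (x 0 = -1) (η x) (η' x)) *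
          ∏ x, seamWeight Q (x 1 = -1) (ν x) (ν' x))

/-! ### Local ground spaces and the parent Hamiltonian -/

/-- The **local PEPS space** `𝒮_{n×m} = {ψ_X : X} ≤ ℓ²(block configurations)` of an `n × m` block:
the range of the block map, i.e. the span of the block states with arbitrary boundary tensor. It
supports the reduced density matrix of the PEPS on the block. Pérez-García–Verstraete–Wolf–Cirac
(2008) §4 (`G_R = range Γ_R`); Schuch–Cirac–Pérez-García (2010) Thm. 5.7 (`𝒮_{2×2}`).
[cite: SchuchCiracPerezGarcia2010, Thm. 5.7] -/
def pepsRange (n m : ℕ) (A : PEPSTensor q D) : Submodule ℂ (SpinSpace (Fin n × Fin m) q) :=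
  Submodule.span ℂ (Set.range fun X : PEPSBoundary D n m => WithLp.toLp 2 (pepsRect n m A X))

/-- The **local term** `h = 1 - Π_{𝒮_{n×m}}` of the parent Hamiltonian: the orthogonal projection
(as a matrix) onto the orthogonal complement of the local PEPS space of the `n × m` block, so
`h ≥ 0` and `ker h = 𝒮_{n×m}`. Pérez-García–Verstraete–Wolf–Cirac (2008) §3 (`h ≥ 0`,
`ker h = S_R`); Schuch–Cirac–Pérez-García (2010) Thm. 5.7, eq. (31).
[cite: SchuchCiracPerezGarcia2010, Thm. 5.7] -/
def pepsLocalTerm (n m : ℕ) (A : PEPSTensor q D) : Op (Fin n × Fin m) q :=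
  projMatrix (pepsRange n m A)ᗮ

/-- The site `x + (a, b)` of the `n × m` block anchored at `x` on the torus. [folklore] -/
def torusBlockSite (L n m : ℕ) (x : TorusSite 2 L) (p : Fin n × Fin m) : TorusSite 2 L :=
  x + ![((p.1 : ℕ) : ZMod L), ((p.2 : ℕ) : ZMod L)]

/-- The `n × m` block `{x + (a, b) : a < n, b < m}` of the torus anchored at `x` (an honest copy of
`Fin n × Fin m` when `n, m ≤ L`). [folklore] -/
def torusBlock (L n m : ℕ) [NeZero L] (x : TorusSite 2 L) : Finset (TorusSite 2 L) :=
  univ.image (torusBlockSite L n m x)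

/-- The block site `x + (a, b)` as an element of `torusBlock L n m x`. [folklore] -/
def torusBlockElem (L n m : ℕ) [NeZero L] (x : TorusSite 2 L) (p : Fin n × Fin m) :
    torusBlock L n m x :=
  ⟨torusBlockSite L n m x p, mem_image_of_mem _ (mem_univ p)⟩

/-- An `n × m`-block operator transported to the block of the torus anchored at `x` (pull-back of
configurations along `p ↦ x + p`, via `Matrix.submatrix`; an honest relabelling when `n, m ≤ L`,
a documented junk value otherwise), cf. `onRingBlock` in one dimension. [folklore] -/
def onTorusBlock (L n m : ℕ) [NeZero L] (x : TorusSite 2 L) (P : Op (Fin n × Fin m) q) :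
    Matrix (torusBlock L n m x → Fin q) (torusBlock L n m x → Fin q) ℂ :=
  P.submatrix (fun σ p => σ (torusBlockElem L n m x p)) (fun σ p => σ (torusBlockElem L n m x p))

/-- **The parent Hamiltonian** `H = Σ_{x ∈ (ℤ/L)²} h_x` of the tensor `A` on the `L × L` torus:
the local term `1 - Π_{𝒮_{n×m}}` placed (tensored with the identity, `localOp`) on the `n × m`
block anchored at every site `x`. Schuch–Cirac–Pérez-García use `n = m = 2`
("the smallest block which allows for an overlapping tiling"). Pérez-García–Verstraete–Wolf–Cirac
(2008) §3, eq. (4); Schuch–Cirac–Pérez-García (2010) Thm. 5.7, eq. (32).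
[cite: SchuchCiracPerezGarcia2010, Thm. 5.7] -/
def pepsParentHamiltonian (L : ℕ) [NeZero L] (n m : ℕ) (A : PEPSTensor q D) :
    Op (TorusSite 2 L) q :=
  ∑ x : TorusSite 2 L, localOp (torusBlock L n m x) (onTorusBlock L n m x (pepsLocalTerm n m A))

/-! ### The ground-space theorem for injective PEPS (named fact) -/

/-- **Parent Hamiltonian theorem for injective PEPS (named fact).** *Let `A` be an injective PEPS
tensor (single-site injectivity, Def. 3.1) and `H_par = Σ_{i,j=1}^{L} h_{i,j}`,
`h_{i,j} = (1 - Π_{𝒮_{2×2}}) ⊗ 1` acting on the square `{i,i+1} × {j,j+1}` of the `L × L` torus.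
Then `H_par` has `|ψ_A⟩` as its unique, frustration-free ground state* — Schuch–Cirac–Pérez-García
(2010) Thm. 5.7 (ground space spanned by the `(g,h)`-closed PEPS, `gh = hg`) together with
Thm. 5.9 (its dimension is the number of pair-conjugacy classes, `= 1` for the trivial group, so
the single closure `|ψ_A⟩` is nonzero and spans), stated there after Thm. 3.5 ("all these results
hold equally for injective PEPS [PVWC2008]"); Pérez-García–Verstraete–Wolf–Cirac (2008) §5 Thm. 3
(every injective PEPS is the unique ground state of a local frustration-free Hamiltonian,
`⋂ G_{R_α ∪ R_β} = G_{∪ R_α} = ℂ|φ⟩`). Since `H_par` is a sum of orthogonal projections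
(`pepsParentHamiltonian_posSemidef`), "frustration-free ground space" = `ker H_par`, and the Lean
statement is: for `2 ≤ L` (the four-block decomposition of the proof needs the `2 × 2` square to
be an honest block), `H ψ = 0 ↔ ψ ∈ ℂ · pepsTorus L A`. Blocked tensors: apply to the blocked
tensor (SCP2010 Lemma 5.2), once the blocking isomorphism is available.
[cite: SchuchCiracPerezGarcia2010, Thm. 5.7 and Thm. 5.9] -/
def pepsParent_groundSpace_of_injective : Prop :=
  ∀ (q D : ℕ) (A : PEPSTensor q D), IsInjectivePEPS 1 1 A →
    ∀ (L : ℕ) [NeZero L], 2 ≤ L →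
      ∀ ψ : TensorIndex (TorusSite 2 L) q → ℂ,
        pepsParentHamiltonian L 2 2 A *ᵥ ψ = 0 ↔ ∃ c : ℂ, ψ = c • pepsTorus L A

/-! ### `G`-injectivity and the ground space with closures (named fact) -/

/-- The action of a matrix `U` on the virtual legs of a tensor under which `G`-invariance is
stated: `U` on the ket legs (left, up) and `U†` on the bra legs (right, down),
`(U · T)_{l u r d} = Σ U_{l l'} U_{u u'} T_{l' u' r' d'} (U†)_{r' r} (U†)_{d' d}` — the four-leg
version of `U_g A^i U_g†` (Schuch–Cirac–Pérez-García (2010) Def. 4.2 (i), Def. 5.1 (i), eq. (25)).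
[cite: SchuchCiracPerezGarcia2010, Def. 5.1] -/
def legAct (U : Matrix (Fin D) (Fin D) ℂ) (T : PEPSVirtual D) : PEPSVirtual D :=
  fun l u r d => ∑ l', ∑ u', ∑ r', ∑ d',
    U l l' * U u u' * star (U r r') * star (U d d') * T l' u' r' d'

/-- The action of `U` on BOUNDARY tensors of an `n × m` block that is dual to `legAct` for the
bilinear block map: `Ū` (entrywise conjugate) on the left and up legs, `U` on the right and down
legs, leg by leg (`U^{⊗m}`, `U^{⊗n}` on the blocked legs, Schuch–Cirac–Pérez-García (2010)
Lemma 5.2). For unitary `U` and a `legAct U`-invariant tensor `A` one has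
`pepsRect n m A (boundaryAct n m U X) = pepsRect n m A X` (the transpose of `boundaryAct n m U`
is `legAct U⁻¹` on every boundary leg, and the inner bonds cancel), so its fixed space is the
"`U_g`-invariant subspace" on which Def. 5.1 (ii) asks for a left inverse.
[cite: SchuchCiracPerezGarcia2010, Def. 5.1 and Lemma 5.2] -/
def boundaryAct (n m : ℕ) (U : Matrix (Fin D) (Fin D) ℂ) (X : PEPSBoundary D n m) :
    PEPSBoundary D n m :=
  fun l u r d => ∑ l', ∑ u', ∑ r', ∑ d',
    (∏ b, star (U (l b) (l' b))) * (∏ a, star (U (u a) (u' a))) * (∏ b, U (r b) (r' b)) *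
      (∏ a, U (d a) (d' a)) * X l' u' r' d'

variable {G : Type*} [Group G]

/-- **Semi-regular representations.** Schuch–Cirac–Pérez-García (2010) Def. 4.5: a unitary
representation `g ↦ U_g` of a finite group is *semi-regular* if it contains every irreducible
representation of `G`. Recorded in the equivalent elementary form "the matrices `U_g`, `g ∈ G`,
are linearly independent": `⇒` is their Lemma 4.6 (`tr[U_g† U_h Δ] = δ_{g,h}`); `⇐` because the
central idempotent `(d_χ/|G|) Σ_g χ(g)⁻ g ≠ 0` of a missing irreducible character `χ` would be a
vanishing linear combination of the `U_g` (Wedderburn decomposition of `ℂ[G]`, cf. their proof of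
Thm. 4.1). [cite: SchuchCiracPerezGarcia2010, Def. 4.5 and Lemma 4.6] -/
def IsSemiregularRep (U : G →* Matrix.unitaryGroup (Fin D) ℂ) : Prop :=
  LinearIndependent ℂ fun g : G => ((U g : Matrix.unitaryGroup (Fin D) ℂ) : Matrix (Fin D) (Fin D) ℂ)

/-- **`G`-injectivity** of (the `n × m` block of) a PEPS tensor w.r.t. a unitary representation
`U` (Schuch–Cirac–Pérez-García (2010) Def. 5.1; blocks: Lemma 5.2): (i) the tensor is invariant
under `U_g` on the virtual level, `legAct (U g) (A s) = A s`; (ii) the block map `𝒫 = Γ_R` has a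
left inverse with `𝒫⁻¹ 𝒫 = Π_𝒰`, the projector onto the `U_g`-invariant boundary tensors —
equivalently (given (i), whence `𝒫 ∘ Π_𝒰 = 𝒫`) `𝒫` is injective on the fixed space of
`boundaryAct n m (U g)`, `g ∈ G`. Semi-regularity of `U` (part of Def. 5.1) is kept as the
separate hypothesis `IsSemiregularRep U`. For the trivial group this is `IsInjectivePEPS`.
[cite: SchuchCiracPerezGarcia2010, Def. 5.1] -/
def IsGInjectivePEPS (U : G →* Matrix.unitaryGroup (Fin D) ℂ) (n m : ℕ) (A : PEPSTensor q D) :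
    Prop :=
  (∀ (g : G) (s : Fin q), legAct (U g : Matrix.unitaryGroup (Fin D) ℂ) (A s) = A s) ∧
    ∀ X : PEPSBoundary D n m,
      (∀ g : G, boundaryAct n m (U g : Matrix.unitaryGroup (Fin D) ℂ) X = X) →
        pepsRect n m A X = 0 → X = 0

/-- **Parent Hamiltonian theorem for `G`-injective PEPS (named fact).** *Let `g ↦ U_g` be a
semi-regular unitary representation of the finite group `G` and `A` a `G`-injective PEPS tensor.
Then the parent Hamiltonian `H_par = Σ_{i,j=1}^{L} h_{i,j}`, `h_{i,j} = (1 - Π_{𝒮_{2×2}}) ⊗ 1` on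
the square `{i,i+1} × {j,j+1}`, has a subspace of frustration-free ground states spanned by the
PEPS `|Ψ(A | (g,h))⟩` with `(g,h)`-closed boundaries, where `gh = hg`* — Schuch–Cirac–Pérez-García
(2010) Thm. 5.7 (with Def. 5.6 for the closures; Thm. 5.9: the dimension is the number `K` of
pair-conjugacy classes of commuting pairs, and closures from different classes are linearly
independent — not restated here). As for the injective case, "frustration-free ground space"
`= ker H_par` (`pepsParentHamiltonian_posSemidef`) and the torus must have `2 ≤ L`.
[cite: SchuchCiracPerezGarcia2010, Thm. 5.7] -/
def pepsParent_groundSpace_of_GInjective : Prop :=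
  ∀ (q D : ℕ) (G : Type) [Group G] [Fintype G] (U : G →* Matrix.unitaryGroup (Fin D) ℂ)
    (A : PEPSTensor q D), IsSemiregularRep U → IsGInjectivePEPS U 1 1 A →
    ∀ (L : ℕ) [NeZero L], 2 ≤ L →
      ∀ ψ : TensorIndex (TorusSite 2 L) q → ℂ,
        pepsParentHamiltonian L 2 2 A *ᵥ ψ = 0 ↔
          ψ ∈ Submodule.span ℂ {φ | ∃ g h : G, g * h = h * g ∧
            φ = pepsTorusTwisted L A (U g : Matrix.unitaryGroup (Fin D) ℂ)
              (U h : Matrix.unitaryGroup (Fin D) ℂ)}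

/-! ### Proved API -/

/-- A product of Kronecker deltas over the points is the Kronecker delta of the functions.
[folklore] -/
theorem prod_ite_apply_eq {α β : Type*} [Fintype α] [DecidableEq β] (f g : α → β) :
    (∏ x, (if f x = g x then (1 : ℂ) else 0)) = if f = g then 1 else 0 := by
  by_cases h : f = g
  · simp [h]
  · obtain ⟨x, hx⟩ : ∃ x, f x ≠ g x := by
      by_contra hc
      push Not at hc
      exact h (funext hc)
    rw [if_neg h]
    exact prod_eq_zero (mem_univ x) (if_neg hx)

/-- The local term is positive semidefinite (an orthogonal projection).
Pérez-García–Verstraete–Wolf–Cirac (2008) §3 (`h ≥ 0`). [cite: PerezGarciaVerstraeteWolfCirac2008PEPS, §3] -/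
theorem pepsLocalTerm_posSemidef (n m : ℕ) (A : PEPSTensor q D) :
    (pepsLocalTerm n m A).PosSemidef :=
  projMatrix_posSemidef _

/-- The local term is Hermitian. [cite: PerezGarciaVerstraeteWolfCirac2008PEPS, §3] -/
theorem pepsLocalTerm_isHermitian (n m : ℕ) (A : PEPSTensor q D) :
    (pepsLocalTerm n m A).IsHermitian :=
  projMatrix_isHermitian _

/-- **The parent Hamiltonian is positive semidefinite**: a sum of positive local terms transported
to blocks (`Matrix.PosSemidef.submatrix`) and tensored with the identity (`posSemidef_localOp`).
Pérez-García–Verstraete–Wolf–Cirac (2008) §3 ("we have again `H ≥ 0`").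
[cite: PerezGarciaVerstraeteWolfCirac2008PEPS, §3] -/
theorem pepsParentHamiltonian_posSemidef (L : ℕ) [NeZero L] (n m : ℕ) (A : PEPSTensor q D) :
    (pepsParentHamiltonian L n m A).PosSemidef := by
  unfold pepsParentHamiltonian
  exact posSemidef_sum _ fun x _ =>
    posSemidef_localOp _ ((pepsLocalTerm_posSemidef n m A).submatrix _)

/-- The parent Hamiltonian is Hermitian. [cite: PerezGarciaVerstraeteWolfCirac2008PEPS, §3] -/
theorem pepsParentHamiltonian_isHermitian (L : ℕ) [NeZero L] (n m : ℕ) (A : PEPSTensor q D) :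
    (pepsParentHamiltonian L n m A).IsHermitian :=
  (pepsParentHamiltonian_posSemidef L n m A).isHermitian

/-- Off the seam the bond weight is the identity matrix entry. [folklore] -/
theorem seamWeight_of_not (P : Matrix (Fin D) (Fin D) ℂ) {cross : Prop} [Decidable cross]
    (h : ¬ cross) (a b : Fin D) : seamWeight P cross a b = if a = b then 1 else 0 := by
  simp [seamWeight, h]

/-- With the identity inserted, every bond weight is `δ_{a b}`, on or off the seam. [folklore] -/
theorem seamWeight_one (cross : Prop) [Decidable cross] (a b : Fin D) :
    seamWeight (1 : Matrix (Fin D) (Fin D) ℂ) cross a b = if a = b then 1 else 0 := by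
  by_cases h : cross <;> simp [seamWeight, h, Matrix.one_apply]

/-- **Trivial closures give back the PEPS**: `pepsTorusTwisted L A 1 1 = pepsTorus L A` (the
doubled bond variables are identified by the `δ` weights). Schuch–Cirac–Pérez-García (2010)
Def. 5.6 with `g = h = 1`. [cite: SchuchCiracPerezGarcia2010, Def. 5.6] -/
theorem pepsTorusTwisted_one_one (L : ℕ) [NeZero L] (A : PEPSTensor q D) :
    pepsTorusTwisted L A 1 1 = pepsTorus L A := by
  funext σ
  simp only [pepsTorusTwisted, pepsTorus, seamWeight_one]
  simp_rw [prod_ite_apply_eq]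
  refine sum_congr rfl fun η _ => ?_
  rw [sum_comm]
  refine sum_congr rfl fun ν _ => ?_
  simp [Finset.sum_ite_eq]


/-- The identity acts trivially on the virtual legs. [folklore] -/
theorem legAct_one (T : PEPSVirtual D) : legAct (1 : Matrix (Fin D) (Fin D) ℂ) T = T := by
  funext l u r d
  simp only [legAct, Matrix.one_apply, RCLike.star_def, apply_ite (starRingEnd ℂ), map_one,
    map_zero]
  simp [Finset.sum_ite_eq]

/-- The identity acts trivially on boundary tensors. [folklore] -/
theorem boundaryAct_one (n m : ℕ) (X : PEPSBoundary D n m) :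
    boundaryAct n m (1 : Matrix (Fin D) (Fin D) ℂ) X = X := by
  funext l u r d
  simp only [boundaryAct, Matrix.one_apply, RCLike.star_def, apply_ite (starRingEnd ℂ), map_one,
    map_zero, prod_ite_apply_eq]
  simp [Finset.sum_ite_eq]

/-- For the trivial representation, `G`-injectivity is injectivity (the invariance condition is
void and every boundary tensor is invariant). Schuch–Cirac–Pérez-García (2010) §5.1 ("includes the
injective one as a special case"). [cite: SchuchCiracPerezGarcia2010, §5.1] -/
theorem isGInjectivePEPS_one_iff (n m : ℕ) (A : PEPSTensor q D) :
    IsGInjectivePEPS (1 : G →* Matrix.unitaryGroup (Fin D) ℂ) n m A ↔ IsInjectivePEPS n m A := by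
  have hlin : ∀ X Y : PEPSBoundary D n m,
      pepsRect n m A (X - Y) = pepsRect n m A X - pepsRect n m A Y := by
    intro X Y
    funext σ
    simp only [pepsRect, Pi.sub_apply, mul_sub, Finset.sum_sub_distrib]
  simp only [IsGInjectivePEPS, IsInjectivePEPS, MonoidHom.one_apply, OneMemClass.coe_one,
    legAct_one, boundaryAct_one, implies_true, true_and, forall_const]
  constructor
  · intro h X Y hXY
    exact sub_eq_zero.1 (h (X - Y) (by rw [hlin, hXY, sub_self]))
  · intro h X hX
    refine h ?_
    rw [hX]
    have h0 := hlin X X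
    rw [sub_self] at h0
    rw [h0, sub_self]


/-! ### The injective case is the `G`-injective case for the trivial group -/

/-- For bond dimension `D = 0` every block state of a nonempty block vanishes (there are no
bond assignments). [folklore] -/
theorem pepsRect_eq_zero_of_D_eq_zero (n m : ℕ) (A : PEPSTensor q 0) (X : PEPSBoundary 0 n m)
    (hn : 0 < n ∨ 0 < m) : pepsRect n m A X = 0 := by
  funext σ
  simp only [pepsRect, Pi.zero_apply]
  rcases hn with hn | hm
  · haveI : IsEmpty (Fin n × Fin (m + 1) → Fin 0) := ⟨fun ν => Fin.elim0 (ν (⟨0, hn⟩, 0))⟩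
    simp
  · haveI : IsEmpty (Fin (n + 1) × Fin m → Fin 0) := ⟨fun η => Fin.elim0 (η (0, ⟨0, hm⟩))⟩
    simp

/-- For `D = 0` the torus PEPS vanishes. [folklore] -/
theorem pepsTorus_eq_zero_of_D_eq_zero (L : ℕ) [NeZero L] (A : PEPSTensor q 0) :
    pepsTorus L A = 0 := by
  funext σ
  haveI : IsEmpty (TorusSite 2 L → Fin 0) := ⟨fun η => Fin.elim0 (η 0)⟩
  simp [pepsTorus]

/-- For `D = 0` the local term of a nonempty block is the identity (`𝒮 = ⊥`). [folklore] -/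
theorem pepsLocalTerm_eq_one_of_D_eq_zero (n m : ℕ) (A : PEPSTensor q 0) (hn : 0 < n ∨ 0 < m) :
    pepsLocalTerm n m A = 1 := by
  have hbot : pepsRange n m A = ⊥ := by
    rw [pepsRange, Submodule.span_eq_bot]
    rintro _ ⟨X, rfl⟩
    change WithLp.toLp 2 (pepsRect n m A X) = 0
    rw [pepsRect_eq_zero_of_D_eq_zero n m A X hn]
    rfl
  rw [pepsLocalTerm, hbot, Submodule.bot_orthogonal_eq_top, projMatrix,
    Submodule.starProjection_top', map_one]

/-- The relabelling of block configurations along the anchor map is injective (the anchor map is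
onto the block by definition of `torusBlock`). [folklore] -/
theorem torusBlock_restrict_injective (L n m : ℕ) [NeZero L] (x : TorusSite 2 L) :
    Function.Injective
      (fun (σ : torusBlock L n m x → Fin q) (p : Fin n × Fin m) => σ (torusBlockElem L n m x p)) := by
  intro σ τ h
  funext ⟨y, hy⟩
  obtain ⟨p, -, rfl⟩ := Finset.mem_image.1 hy
  exact congr_fun h p

/-- Transporting the identity to a block gives the identity. [folklore] -/
theorem onTorusBlock_one (L n m : ℕ) [NeZero L] (x : TorusSite 2 L) :
    onTorusBlock L n m x (1 : Op (Fin n × Fin m) q) = 1 :=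
  submatrix_one _ (torusBlock_restrict_injective L n m x)

/-- For `D = 0` the parent Hamiltonian of a nonempty block shape is `L² · 1`. [folklore] -/
theorem pepsParentHamiltonian_eq_of_D_eq_zero (L : ℕ) [NeZero L] (n m : ℕ) (A : PEPSTensor q 0)
    (hn : 0 < n ∨ 0 < m) :
    pepsParentHamiltonian L n m A = (Fintype.card (TorusSite 2 L) : ℂ) • (1 : Op (TorusSite 2 L) q) := by
  simp only [pepsParentHamiltonian, pepsLocalTerm_eq_one_of_D_eq_zero n m A hn, onTorusBlock_one,
    localOp_one, sum_const, card_univ, nsmul_eq_mul, mul_one]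
  rw [Nat.cast_smul_eq_nsmul, Nat.smul_one_eq_cast]

/-- **The injective ground-space theorem follows from the `G`-injective one** (trivial group,
`U = 1`: the invariance condition is void, every boundary tensor is invariant, the trivial
one-dimensional representation on `ℂ^D`, `D ≥ 1`, is semi-regular, and the only closure is
`(1,1)`, giving back `pepsTorus`); `D = 0` is the degenerate case `H = L² · 1`, `ψ_A = 0`.
Schuch–Cirac–Pérez-García (2010) §5.1 ("includes the injective one as a special case").
[cite: SchuchCiracPerezGarcia2010, §5.1] -/
theorem pepsParent_groundSpace_of_injective_of_GInjective
    (h : pepsParent_groundSpace_of_GInjective) : pepsParent_groundSpace_of_injective := by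
  intro q D A hA L _ hL ψ
  rcases Nat.eq_zero_or_pos D with rfl | hD
  · rw [pepsTorus_eq_zero_of_D_eq_zero, pepsParentHamiltonian_eq_of_D_eq_zero L 2 2 A (Or.inl two_pos),
      smul_mulVec, one_mulVec]
    simp only [smul_zero, exists_const]
    rw [smul_eq_zero]
    simp [NeZero.ne]
  · haveI : NeZero D := ⟨hD.ne'⟩
    have hsr : IsSemiregularRep (1 : Unit →* Matrix.unitaryGroup (Fin D) ℂ) := by
      rw [IsSemiregularRep, linearIndependent_unique_iff]
      simp
    have hG : IsGInjectivePEPS (1 : Unit →* Matrix.unitaryGroup (Fin D) ℂ) 1 1 A :=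
      (isGInjectivePEPS_one_iff 1 1 A).2 hA
    rw [h q D Unit 1 A hsr hG L hL ψ]
    have hS : {φ : TensorIndex (TorusSite 2 L) q → ℂ | ∃ g h : Unit, g * h = h * g ∧
        φ = pepsTorusTwisted L A ((1 : Unit →* Matrix.unitaryGroup (Fin D) ℂ) g :
          Matrix.unitaryGroup (Fin D) ℂ) ((1 : Unit →* Matrix.unitaryGroup (Fin D) ℂ) h :
          Matrix.unitaryGroup (Fin D) ℂ)} = {pepsTorus L A} := by
      ext φ
      simp [pepsTorusTwisted_one_one]
    rw [hS, Submodule.mem_span_singleton]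
    constructor
    · rintro ⟨c, rfl⟩
      exact ⟨c, rfl⟩
    · rintro ⟨c, rfl⟩
      exact ⟨c, rfl⟩
end QLattice

end Literature.MathematicalPhysics.QuantumLattice
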